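import Summits.CriticalPhenomena.PercolationContinuityZ3.Theorems.PercNearOneGluingNoHeavyLowerTailSahiGoodAxis

/-!
# The `q`-interpolated two-level letter: `E_3(U) ≥ q_a² E_3(U^{a←1}) + (1−q_a)² E_3(U^{a←0})`, its two-level form, and the
# uniform-measure rung HALF(½) ⟹ Sahi's `C_3` at `q ≡ 1/2`

Support file of the one-cut programme (crux `NoHeavyLowerTail`, stmt-CriticalPhenomena-4575; cell `prim-bnk`, seat bnk-2 gen 11,
memo `run/shared/lean/prim/prim-l12/FROM-prim-bnk-2-g11-GOOD-AXIS.md` §12; companion of `…SahiGoodAxis` (∃-rung GA) and of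
`…SahiUniformReduction` (p274952: `SahiUniform.kahnConjecture_iff_forall_half`, `C_3` at `q ≡ 1/2` on every `Fin r` ⟺ Kahn's Conjecture 5,
a transport of the tree's `sahiConjecture_iff_forall_uniformWeight_fin`; and `SahiUniform.kahnConjecture_of_half`: HALF(½) ⟹ Kahn)).

For the fibre cubic `Φ_a` of a triple `U` along `a` (so `Φ_a(q_a) = E_3(U)`, `Φ_a(1), Φ_a(0)` = `E_3` of the sections `G ⊇ H`):
* `sqDefect_eq_twoLevel` — **`Φ(q) − q²Φ(1) − (1−q)²Φ(0) = q(1−q)·[twoLevelForm μ_q G H − q·∏_i(μ(G_i) − μ(H_i))]`** (cubic algebra: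
  `= q(1−q)[(1−q)·BOTTOM + q·TOP]`, the `q`-convex combination of the lane's two endpoint letters `BOTTOM = 3β₁−β₀ = twoLevelForm`,
  `TOP = 3β₂−β₃ = twoLevelForm − Πδ`).  So the per-axis condition **SqDom (`0 ≤ sqDefect`): `E_3(U) ≥ q_a²E_3(U^{a←1}) + (1−q_a)²E_3(U^{a←0})`** is
  `twoLevelForm(G,H) ≥ q_a·Πδ` — MINUS at `q_a = 0`, PLUS at `q_a = 1`; exponent `2` is SHARP
  (`(x₀(x₁∨x₂∨x₃), x₁, x₀x₂∨x₁x₂∨x₃)` along `x₃`: `E_3(U) = (1−q₃)²E_3(U^{3←0})` identically; memo §12).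
* `sqDom_of_sahiTwoLevelPlus` — `SahiTwoLevelPlus` gives SqDom along every axis (`Πδ ≥ q_aΠδ`); over ALL product measures
  '`SqDom` everywhere' is equivalent to PLUS (the parameter of the sliced coordinate is free), but PER MEASURE it is weaker, and:
* **`sahiE_three_nonneg_of_sqDom`** — for a FIXED cube and product measure `μ_q`: if every triple of increasing events satisfies
  `SqDom` along every axis, then `E_3(μ_q; ·) ≥ 0` for all triples (induction on a determining set; sections keep `q`).
* **HALF(½)** (`SahiTwoLevelHalf.Half`, @[conjecture], OPEN): `SqDom` along every axis for every triple of every `Fin r` at `q ≡ 1/2`, i.e.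
  `E_3(U) ≥ ¼[E_3(U^{a←1}) + E_3(U^{a←0})]`, i.e. `β₁ + β₂ ≥ (β₀ + β₃)/3` for the Bernstein coefficients along every axis (GA(½) is
  '`β₁+β₂ ≥ β₀+β₃` along SOME axis').  HALF(½) ⟸ PLUS(½) ∧ MINUS(½) ⟸ comb ORDER-1, hence census-clean where those are (`m ≤ 5`
  exhaustive comb census; this gen's exact-best-response runs at `q ≡ 1/2`: PLUS `n ≤ 8`, BOTTOM `n = 6`, HALF `n = 5–8`, 0 negatives).
  **`c3_uniform_of_half`: HALF(½) ⟹ `E_3 ≥ 0` for every triple of increasing events of every `Fin r` at `q ≡ 1/2`** — which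
  is the right-hand side of `SahiUniform.kahnConjecture_iff_forall_half` (`…SahiUniformReduction`), equivalent there to Kahn's Conjecture 5.
Everything below is proved; axioms standard; HALF(½), PLUS and `C_3` remain OPEN (obligations, never facts). [this work]
-/

noncomputable section

open scoped Classical

namespace Summit.CriticalPhenomena.PercolationContinuityZ3.Theorems

open Finset Function
open Literature.Combinatorics.Sahi2008
open Literature.Probability.LatticeModels (prodBernoulli)
open Literature.Probability.Percolation (DeterminedBy determinedBy_iff)
open Literature.Probability.Percolation.DecisionTree (ind ind_of_mem ind_of_not_mem ind_nonneg)
open SahiComb SahiLogDerivEnd SahiTwoLevel SahiGoodAxis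

namespace SahiTwoLevelHalf

section Cubic

variable {κ : Type*} [Fintype κ]

/-- **The square-weighted sectional defect along `a`**: `Φ_a(q_a) − [q_a²·Φ_a(1) + (1−q_a)²·Φ_a(0)]`, i.e.
`E_3(μ_q;U) − q_a²·E_3(μ_q;U^{a←1}) − (1−q_a)²·E_3(μ_q;U^{a←0})`; `SqDom` along `a` means it is `≥ 0`. [this work] -/
def sqDefect (q : κ → unitInterval) (a : κ) (U : Fin 3 → Set (Set κ)) : ℝ :=
  cubicE3 q a (ind (U 0)) (ind (U 1)) (ind (U 2)) (q a)
    - ((q a : ℝ) ^ 2 * cubicE3 q a (ind (U 0)) (ind (U 1)) (ind (U 2)) 1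
        + (1 - (q a : ℝ)) ^ 2 * cubicE3 q a (ind (U 0)) (ind (U 1)) (ind (U 2)) 0)

/-- **The square-weighted defect is `q(1−q)` times `twoLevelForm − q·Πδ`**:
`Φ(q) − q²Φ(1) − (1−q)²Φ(0) = q(1−q)·[twoLevelForm μ_q G H − q·∏_i (μ(G_i) − μ(H_i))]`, `G = U^{a←1}`, `H = U^{a←0}`. [this work] -/
theorem sqDefect_eq_twoLevel (q : κ → unitInterval) (a : κ) (U : Fin 3 → Set (Set κ)) :
    sqDefect q a U =
      (q a : ℝ) * (1 - (q a : ℝ)) *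
        (twoLevelForm (fun A => (prodBernoulli q).real A) (fun i => secAt a true (U i)) (fun i => secAt a false (U i))
          - (q a : ℝ) * ∏ i, ((prodBernoulli q).real (secAt a true (U i)) - (prodBernoulli q).real (secAt a false (U i)))) := by
  rw [twoLevelForm_secAt_eq', sqDefect]
  have hsec : ∀ (i : Fin 3) (b : Bool), (prodBernoulli q).real (secAt a b (U i)) = secEx q a (ind (U i)) b := by
    intro i b
    rw [secEx_ind_eq_ex_secAt, ex_bernoulliWeight_ind]
  simp only [hsec, Fin.prod_univ_three]
  simp only [cubicE3, derivE3AtZero]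
  ring

/-- `SqDom` along `a` follows from `twoLevelForm(G,H) ≥ q_a·Πδ` for the sections along `a`. [this work] -/
theorem sqDom_of_twoLevelForm_ge (q : κ → unitInterval) (U : Fin 3 → Set (Set κ)) (a : κ)
    (h : (q a : ℝ) * ∏ i, ((prodBernoulli q).real (secAt a true (U i)) - (prodBernoulli q).real (secAt a false (U i))) ≤
      twoLevelForm (fun A => (prodBernoulli q).real A) (fun i => secAt a true (U i)) (fun i => secAt a false (U i))) :
    0 ≤ sqDefect q a U := by
  rw [sqDefect_eq_twoLevel]
  exact mul_nonneg (mul_nonneg (q a).2.1 (sub_nonneg.2 (q a).2.2)) (sub_nonneg.2 h)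

/-- **PLUS gives `SqDom` along every axis** (`twoLevelForm ≥ Πδ ≥ q_a·Πδ`). [this work] -/
theorem sqDom_of_sahiTwoLevelPlus (hP : SahiTwoLevelPlus) {κ : Type} [Fintype κ] (q : κ → unitInterval)
    (U : Fin 3 → Set (Set κ)) (hU : ∀ i, IsUpperSet (U i)) (a : κ) : 0 ≤ sqDefect q a U := by
  refine sqDom_of_twoLevelForm_ge q U a ?_
  have hprod : 0 ≤ ∏ i, ((prodBernoulli q).real (secAt a true (U i)) - (prodBernoulli q).real (secAt a false (U i))) :=
    prod_nonneg fun i _ => sub_nonneg.2 (MeasureTheory.measureReal_mono (secAt_false_subset_true (hU i) a))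
  have h1 := hP κ q (fun i => secAt a true (U i)) (fun i => secAt a false (U i))
    (fun i => isUpperSet_secAt a true (hU i)) (fun i => isUpperSet_secAt a false (hU i)) fun i => secAt_false_subset_true (hU i) a
  have hq1 : (q a : ℝ) ≤ 1 := (q a).2.2
  nlinarith

end Cubic

/-! ### Per-measure induction -/

section Induction

variable {κ : Type} [Fintype κ]

/-- **Per-measure induction**: on a FIXED finite cube with a FIXED product measure `μ_q`, if every triple of increasing events satisfies
`SqDom` along every axis, then `E_3(μ_q; 1_U) ≥ 0` for every triple of increasing events determined by a finite set `S`
(induction on `S`; both sections are increasing, live on the same cube with the same `q`, and are determined by `S ∖ {a}`). [this work] -/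
theorem sahiE_three_nonneg_of_sqDom_determinedBy (q : κ → unitInterval)
    (h : ∀ U : Fin 3 → Set (Set κ), (∀ i, IsUpperSet (U i)) → ∀ a, 0 ≤ sqDefect q a U) :
    ∀ (S : Finset κ) (U : Fin 3 → Set (Set κ)), (∀ i, IsUpperSet (U i)) → (∀ i, DeterminedBy (U i) (↑S : Set κ)) →
      0 ≤ sahiE (bernoulliWeight q) 3 (fun i => ind (U i)) := by
  intro S
  induction S using Finset.induction_on with
  | empty =>
    intro U _ hUd
    rw [sahiE_bernoulliWeight_eq_sum_combCoeff]
    exact sum_nonneg fun j _ => mul_nonneg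
      (combCoeff_ind_nonneg_of_trivial U (fun i => eq_empty_or_univ_of_determinedBy_empty (hUd i)) j) (bern_nonneg _ _ _)
  | insert a S haS ih =>
    intro U hU hUd
    have hsec : ∀ (b : Bool) (i : Fin 3), DeterminedBy (secAt a b (U i)) (↑S : Set κ) := fun b i => by
      simpa only [erase_insert haS] using determinedBy_secAt a b (hUd i)
    have h1 : 0 ≤ cubicE3 q a (ind (U 0)) (ind (U 1)) (ind (U 2)) 1 := by
      rw [FibreCubic.cubicE3_one_eq_secAt]
      exact ih _ (fun i => isUpperSet_secAt a true (hU i)) (hsec true)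
    have h0 : 0 ≤ cubicE3 q a (ind (U 0)) (ind (U 1)) (ind (U 2)) 0 := by
      rw [cubicE3_zero_eq_secAt]
      exact ih _ (fun i => isUpperSet_secAt a false (hU i)) (hsec false)
    rw [← cubicE3_self_eq q a U]
    have hd := h U hU a
    rw [sqDefect, sub_nonneg] at hd
    exact le_trans (add_nonneg (mul_nonneg (sq_nonneg _) h1) (mul_nonneg (sq_nonneg _) h0)) hd

/-- **`SqDom` along every axis (for one cube and one product measure) gives `E_3(μ_q; ·) ≥ 0` on that cube.** [this work] -/
theorem sahiE_three_nonneg_of_sqDom (q : κ → unitInterval)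
    (h : ∀ U : Fin 3 → Set (Set κ), (∀ i, IsUpperSet (U i)) → ∀ a, 0 ≤ sqDefect q a U)
    (U : Fin 3 → Set (Set κ)) (hU : ∀ i, IsUpperSet (U i)) : 0 ≤ sahiE (bernoulliWeight q) 3 (fun i => ind (U i)) :=
  sahiE_three_nonneg_of_sqDom_determinedBy q h Finset.univ U hU fun _ => determinedBy_coe_univ _

end Induction

/-! ### The uniform-measure rung HALF(½) -/

/-- The fair parameter `1/2 ∈ [0,1]`. [folklore] -/
def half : unitInterval := ⟨1 / 2, by norm_num, by norm_num⟩

/-- **Conjecture HALF(½)** (bnk-2 gen 11; INEQ-CLAIMS row HALF): at the UNIFORM measure on every finite cube `Fin r`, every triple of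
increasing events satisfies `SqDom` along every axis: `E_3(U) ≥ ¼[E_3(U^{a←1}) + E_3(U^{a←0})]`, equivalently
`twoLevelForm(U^{a←1},U^{a←0}) ≥ ½·Πδ`, equivalently `β₁ + β₂ ≥ (β₀ + β₃)/3` along every axis.  Implied by PLUS(½) ∧ MINUS(½) (hence by
comb ORDER-1); sharp (memo §12); census in the file header.  With `…SahiUniformReduction` it implies Kahn's Conjecture 5
(`SahiUniform.kahnConjecture_of_half`: `c3_uniform_of_half` gives exactly the right-hand side of `SahiUniform.kahnConjecture_iff_forall_half`).  OPEN; an obligation, never a fact. [this work] [status: open] -/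
@[conjecture] def Half : Prop :=
  ∀ (r : ℕ) (U : Fin 3 → Set (Set (Fin r))), (∀ i, IsUpperSet (U i)) → ∀ a : Fin r, 0 ≤ sqDefect (fun _ : Fin r => half) a U

/-- **HALF(½) ⟹ Sahi's `C_3` at the uniform measure on every finite cube** (the right-hand side of
`SahiUniform.kahnConjecture_iff_forall_half` of `…SahiUniformReduction`, equivalent there to Kahn's Conjecture 5). [this work] -/
theorem c3_uniform_of_half (hH : Half) (r : ℕ) (U : Fin 3 → Set (Set (Fin r)))
    (hU : ∀ i, IsUpperSet (U i)) : 0 ≤ sahiE (bernoulliWeight (fun _ : Fin r => half)) 3 (fun i => ind (U i)) :=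
  sahiE_three_nonneg_of_sqDom (fun _ : Fin r => half) (fun V hV a => hH r V hV a) U hU

/-- **PLUS (all product measures) ⟹ `C_3` via `SqDom`** — a five-line route to the tree's `masterFamilyNonneg_three_of_sahiTwoLevelPlus`
that avoids the log-derivative schema: PLUS gives `SqDom` along every axis of every cube, and the per-measure induction concludes.
[this work] -/
theorem masterFamilyNonneg_three_of_sahiTwoLevelPlus' (hP : SahiTwoLevelPlus) : MasterFamilyNonneg 3 :=
  fun _ _ q U hU => sahiE_three_nonneg_of_sqDom q (fun V hV a => sqDom_of_sahiTwoLevelPlus hP q V hV a) U hU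

end SahiTwoLevelHalf

end Summit.CriticalPhenomena.PercolationContinuityZ3.Theorems
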